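import Literature.RepresentationTheory.AlgebraicGroups.CayleyOmegaProcess
import Literature.RepresentationTheory.AlgebraicGroups.FirstFundamentalTheoremSLRelative
import HarnessLib

/-!
# FFT for `SL_N`, step 2: the Ω-process and the proof of Theorem 3.2.1

Topic `Literature/RepresentationTheory/AlgebraicGroups`. This file DISCHARGES the named fact
`Sturmfels1993_thm321_FFT_SL` of `FirstFundamentalTheoremSL.lean` (B. Sturmfels, *Algorithms in
Invariant Theory* (1993), **Theorem 3.2.1**, first fundamental theorem of invariant theory: the
`SL`-invariants of a generic matrix are generated by its maximal minors), as
`Sturmfels1993_thm321_FFT_SL_holds`.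

## The proof formalized

Sturmfels's printed proof of Thm. 3.2.1 (pp. 90–94) runs the straightening algorithm
(Thm. 3.1.7, a Gröbner basis of the Grassmann–Plücker ideal) on an enlarged bracket ring; the
straightening law is not available in Mathlib. We formalize instead the classical proof by
**Cayley's Ω-process**, assembled from results that ARE printed (and proved) in the same book:

1. (Lemma 3.2.3, `FirstFundamentalTheoremSLRelative.lean`) reduce to a homogeneous invariant `I`
   of degree `n = Np`; it is a relative `GL_N`-invariant of index `p`, and for the generic matrix
   `t`: `I(tX) = det(t)^p · I(X)` in `ℂ[x][t]` (cf. (4.3.23)).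
2. (§4.3, `CayleyOmegaProcess.lean`) apply `Ω_t^p`, `Ω = det(∂/∂t_{ij})`: the right-hand side
   becomes `c · I(X)` with `c = Ω^p det(t)^p` a positive integer (Lemma 4.3.2, (4.3.14)), exactly
   as in Sturmfels's proof of Hilbert's finiteness theorem, (4.3.24).
3. (this file) the left-hand side: by the chain rule, eq. (4.3.5) of the proof of the first main
   rule Thm. 4.3.4 — `∂/∂t_{ab} F(tX) = ∑_j x_{bj} (∂F/∂x_{aj})(tX)` — and antisymmetrization over
   `π ∈ S_N` ((4.3.6)–(4.3.7)), `Ω_t F(tX) = ∑_c [c](X) · (∂_{x_{1c₁}} ⋯ ∂_{x_{Nc_N}} F)(tX)`, a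
   `ℂ[x]`-combination of translates with BRACKET (maximal minor) coefficients
   (`cayleyOmega_genericLeftTranslate`); iterating `p` times on `I` of degree `Np` leaves
   translates of constants, so `Ω^p I(tX) = c · I(X)` lies in the bracket ring, and `c ≠ 0` gives
   `I ∈ ℂ[maximal minors]`.

No hypothesis `N ≤ M` is needed (for `M < N` both sides are the constants).

## References

* [Sturmfels1993] B. Sturmfels, *Algorithms in Invariant Theory*, Springer 1993: Thm. 3.2.1 and
  Lemma 3.2.3 (§3.2, pp. 89–90); §4.3: Lemma 4.3.2, Lemma 4.3.3, (4.3.3), Thm. 4.3.4 with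
  (4.3.5)–(4.3.7), Cor. 4.3.6, proof of Thm. 4.3.1 ((4.3.23)–(4.3.25)) (held; pp. 155–161).
* [Weyl1939] H. Weyl, *The Classical Groups*, Thm. (II.6.A) (classical attribution; not held).
-/

noncomputable section

open scoped BigOperators

namespace Literature.RepresentationTheory.AlgebraicGroups

open MvPolynomial

variable {N M : ℕ}

/-! ### The chain rule for `F(tX)` (Sturmfels 1993, (4.3.5)) -/

/-- `∂/∂t_{ab}` of the linear form `(tX)_{q} = ∑_k t_{q₁k} x_{kq₂}` is `x_{b q₂}` if `q₁ = a` and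
`0` otherwise. [cite: Sturmfels1993, §4.3 eq. (4.3.5)] -/
theorem pderiv_genericLeftTranslate_X (ab : Fin N × Fin N) (q : Fin N × Fin M) :
    pderiv ab (genericLeftTranslate N M (X q)) =
      if q.1 = ab.1 then C (X (ab.2, q.2)) else 0 := by
  classical
  simp only [genericLeftTranslate_X, map_sum, pderiv_mul, pderiv_C, mul_zero, add_zero, pderiv_X,
    Pi.single_apply, Prod.ext_iff]
  by_cases hq : q.1 = ab.1
  · simp [hq]
  · simp [hq]

/-- **The chain rule** (Sturmfels 1993, eq. (4.3.5), one derivative):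
`∂/∂t_{ab} F(tX) = ∑_j x_{bj} · (∂F/∂x_{aj})(tX)`. [cite: Sturmfels1993, §4.3 eq. (4.3.5)] -/
theorem pderiv_genericLeftTranslate (ab : Fin N × Fin N) (F : MvPolynomial (Fin N × Fin M) ℂ) :
    pderiv ab (genericLeftTranslate N M F) =
      ∑ j : Fin M, C (X (ab.2, j)) * genericLeftTranslate N M (pderiv (ab.1, j) F) := by
  classical
  induction F using MvPolynomial.induction_on with
  | C c => simp
  | add p q hp hq => simp only [map_add, hp, hq, mul_add, Finset.sum_add_distrib]
  | mul_X p q h =>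
    rw [map_mul, pderiv_mul, h, pderiv_genericLeftTranslate_X]
    have hsum : ∑ j : Fin M, C (X (ab.2, j)) * genericLeftTranslate N M (pderiv (ab.1, j) (p * X q)) =
        (∑ j : Fin M, C (X (ab.2, j)) * genericLeftTranslate N M (pderiv (ab.1, j) p)) *
            genericLeftTranslate N M (X q) +
          genericLeftTranslate N M p *
            ∑ j : Fin M, C (X (ab.2, j)) * genericLeftTranslate N M (pderiv (ab.1, j) (X q)) := by
      rw [Finset.sum_mul, Finset.mul_sum, ← Finset.sum_add_distrib]
      refine Finset.sum_congr rfl fun j _ => ?_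
      rw [pderiv_mul, map_add, map_mul, map_mul]
      ring
    have hX : ∑ j : Fin M, C (X (ab.2, j)) * genericLeftTranslate N M (pderiv (ab.1, j) (X q)) =
        if q.1 = ab.1 then C (X (ab.2, q.2)) else 0 := by
      simp_rw [pderiv_X, Pi.single_apply, apply_ite (genericLeftTranslate N M), map_one, map_zero,
        mul_ite, mul_one, mul_zero]
      rcases q with ⟨q₁, q₂⟩
      by_cases hq : q₁ = ab.1
      · subst hq
        simp
      · simp [hq]
    rw [hsum, hX]

/-- **The iterated chain rule** ((4.3.5) for `k` derivatives): for `t`-variables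
`v 0, …, v (n-1)`,
`∂_{t_{v 0}} ⋯ ∂_{t_{v(n-1)}} F(tX) = ∑_{j} (∏_s x_{(v s)₂ j_s}) · (∂_{x_{(v 0)₁ j₀}} ⋯ F)(tX)`.
[cite: Sturmfels1993, §4.3 eq. (4.3.5)] -/
theorem listProd_pderiv_genericLeftTranslate {n : ℕ} (v : Fin n → Fin N × Fin N)
    (F : MvPolynomial (Fin N × Fin M) ℂ) :
    (List.ofFn fun s => (pderiv (v s)).toLinearMap).prod (genericLeftTranslate N M F) =
      ∑ j : Fin n → Fin M, C (∏ s, X ((v s).2, j s)) *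
        genericLeftTranslate N M
          ((List.ofFn fun s => (pderiv ((v s).1, j s)).toLinearMap).prod F) := by
  induction n with
  | zero => simp
  | succ n ih =>
    rw [List.ofFn_succ, List.prod_cons, Module.End.mul_apply, ih (fun s => v s.succ), map_sum]
    simp_rw [Derivation.coeFn_coe, pderiv_C_mul, pderiv_genericLeftTranslate, Finset.mul_sum]
    rw [Finset.sum_comm, ← (Fin.consEquiv fun _ => Fin M).sum_comp, Fintype.sum_prod_type]
    refine Finset.sum_congr rfl fun j₀ _ => Finset.sum_congr rfl fun j' _ => ?_
    simp only [Fin.consEquiv, Equiv.coe_fn_mk, Fin.prod_univ_succ, Fin.cons_zero, Fin.cons_succ,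
      List.ofFn_succ, List.prod_cons, Module.End.mul_apply, Derivation.coeFn_coe, map_mul]
    ring

/-- **`Ω` on translates** (Sturmfels 1993, proof of Thm. 4.3.4, (4.3.5)–(4.3.7) specialised to
`s := X`): `Ω_t F(tX) = ∑_{c} [c](X) · (∂_{x_{1 c₁}} ⋯ ∂_{x_{N c_N}} F)(tX)`, where `[c]` is the
maximal minor of `X` on the columns `c` — antisymmetrizing the chain rule over `π ∈ S_N` turns the
coefficient `∑_π sign π ∏_i x_{π i, c_i}` into the bracket. [cite: Sturmfels1993, Thm. 4.3.4] -/
theorem cayleyOmega_genericLeftTranslate (F : MvPolynomial (Fin N × Fin M) ℂ) :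
    cayleyOmega (Fin N) _ (genericLeftTranslate N M F) =
      ∑ c : Fin N → Fin M, C (maximalMinor N M c) *
        genericLeftTranslate N M ((List.ofFn fun i => (pderiv (i, c i)).toLinearMap).prod F) := by
  rw [cayleyOmega_fin_eq, LinearMap.sum_apply]
  simp_rw [LinearMap.smul_apply, listProd_pderiv_genericLeftTranslate, Finset.smul_sum]
  rw [Finset.sum_comm]
  refine Finset.sum_congr rfl fun c _ => ?_
  simp_rw [← smul_mul_assoc]
  rw [← Finset.sum_mul]
  congr 1
  rw [maximalMinor, Matrix.det_apply', map_sum]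
  refine Finset.sum_congr rfl fun π _ => ?_
  rw [map_mul, map_intCast, zsmul_eq_mul]
  rfl

/-! ### Iterating `Ω` on a relative invariant -/

/-- **The bracket ring survives `Ω^t`**: for `F` homogeneous of degree `N t`,
`Ω^t F(tX)` lies in the image of the bracket ring `ℂ[maximal minors] ⊆ ℂ[x]` inside `ℂ[x][t]`
(each `Ω` trades `N` degrees of `F` for one bracket factor, by `cayleyOmega_genericLeftTranslate`;
after `t` steps only translates of constants remain). This is the left-hand side computation of
(4.3.24)–(4.3.25) in Sturmfels's Ω-process proofs, with the brackets made explicit.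
[cite: Sturmfels1993, §4.3 (4.3.24)] -/
theorem cayleyOmega_pow_genericLeftTranslate_mem (t : ℕ) :
    ∀ F : MvPolynomial (Fin N × Fin M) ℂ, F.IsHomogeneous (N * t) →
      (cayleyOmega (Fin N) _ ^ t) (genericLeftTranslate N M F) ∈
        (Algebra.adjoin ℂ (Set.range (maximalMinor N M))).map
          (IsScalarTower.toAlgHom ℂ (MvPolynomial (Fin N × Fin M) ℂ) (GenRing N M)) := by
  induction t with
  | zero =>
    intro F hF
    rw [mul_zero, ← totalDegree_zero_iff_isHomogeneous, totalDegree_eq_zero_iff_eq_C] at hF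
    rw [hF, pow_zero, Module.End.one_apply]
    refine Subalgebra.mem_map.2 ⟨C (coeff 0 F), Subalgebra.algebraMap_mem _ _, ?_⟩
    simp [genericLeftTranslate]
  | succ t ih =>
    intro F hF
    rw [pow_succ, Module.End.mul_apply, cayleyOmega_genericLeftTranslate, map_sum]
    refine Subalgebra.sum_mem _ fun c _ => ?_
    rw [C_mul', map_smul, smul_eq_C_mul]
    refine Subalgebra.mul_mem _ ?_ (ih _ ?_)
    · exact Subalgebra.mem_map.2 ⟨maximalMinor N M c, Algebra.subset_adjoin ⟨c, rfl⟩, rfl⟩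
    · have h := isHomogeneous_listProd_pderiv (fun i : Fin N => ((i, c i) : Fin N × Fin M)) hF
      rwa [Nat.mul_succ, Nat.add_sub_cancel] at h

/-- **FFT, homogeneous case**: a homogeneous `SL_N`-invariant lies in the bracket ring
(`N ≥ 1`). Apply `Ω^p` to `I(tX) = det(t)^p I(X)`: the left side is in the bracket ring, the
right side is `c · I(X)` with `c` a non-zero integer. [cite: Sturmfels1993, Thm. 3.2.1] -/
theorem mem_adjoin_maximalMinor_of_isHomogeneous {f : MvPolynomial (Fin N × Fin M) ℂ}
    (hf : f ∈ slInvariantSubalgebra N M) {n : ℕ} (hn : f.IsHomogeneous n) (hN : 0 < N) :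
    f ∈ Algebra.adjoin ℂ (Set.range (maximalMinor N M)) := by
  by_cases hf0 : f = 0
  · rw [hf0]
    exact Subalgebra.zero_mem _
  have hnp : n = N * (n / N) := degree_eq_mul_div_of_mem hf hn hN hf0
  have hmem := cayleyOmega_pow_genericLeftTranslate_mem (N := N) (M := M) (n / N) f (hnp ▸ hn)
  obtain ⟨z, hz, hΩ⟩ :=
    cayleyOmega_pow_apply_det_pow (m := Fin N) (MvPolynomial (Fin N × Fin M) ℂ) (n / N)
  rw [genericLeftTranslate_eq hf hn hN, mul_comm, C_mul', map_smul, hΩ, smul_eq_C_mul, ← map_mul]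
    at hmem
  obtain ⟨b, hb, hbeq⟩ := Subalgebra.mem_map.1 hmem
  have hbeq' : b = f * (z : MvPolynomial (Fin N × Fin M) ℂ) := C_injective _ _ (by simpa using hbeq)
  have hz' : (z : ℂ) ≠ 0 := Int.cast_ne_zero.2 hz
  have hfz : f = b * C ((z : ℂ)⁻¹) := by
    rw [hbeq', ← map_intCast (C : ℂ →+* MvPolynomial (Fin N × Fin M) ℂ), mul_assoc, ← map_mul,
      mul_inv_cancel₀ hz', map_one, mul_one]
  rw [hfz]
  exact Subalgebra.mul_mem _ hb (Subalgebra.algebraMap_mem _ _)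

/-- **First fundamental theorem of invariant theory for `SL_N`** (Sturmfels 1993, Thm. 3.2.1;
Weyl 1939, Thm. (II.6.A)): the named fact `Sturmfels1993_thm321_FFT_SL` holds — every polynomial
in the entries of an `N × M` matrix invariant under left multiplication by `SL_N(ℂ)` is a
polynomial in the maximal minors. Proof: Cayley's Ω-process (module docstring).
[cite: Sturmfels1993, Thm. 3.2.1] -/
theorem Sturmfels1993_thm321_FFT_SL_holds : Sturmfels1993_thm321_FFT_SL := by
  intro N M _ f hf
  rcases Nat.eq_zero_or_pos N with hN | hN
  · subst hN
    rw [MvPolynomial.eq_C_of_isEmpty f]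
    exact Subalgebra.algebraMap_mem _ _
  · rw [← sum_homogeneousComponent f]
    exact Subalgebra.sum_mem _ fun k _ =>
      mem_adjoin_maximalMinor_of_isHomogeneous (homogeneousComponent_mem_slInvariantSubalgebra hf k)
        (homogeneousComponent_isHomogeneous k f) hN

/-- The FFT as an equality of subalgebras, unconditionally: `ℂ[x_{ij}]^{SL_N} = ℂ[maximal minors]`
for `N ≤ M`. [cite: Sturmfels1993, Thm. 3.2.1] -/
theorem slInvariantSubalgebra_eq_adjoin_maximalMinor (hNM : N ≤ M) :
    slInvariantSubalgebra N M = Algebra.adjoin ℂ (Set.range (maximalMinor N M)) :=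
  Sturmfels1993_thm321_FFT_SL_holds.eq_adjoin hNM

end Literature.RepresentationTheory.AlgebraicGroups

end
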